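import Summits.QuantumFields.BalabanUV.Beta.FP.TorusNestedReadoutTranslate

/-!
# `BalabanUV.Beta.FP.TorusNestedReadoutTranslateRows` — road «FP», binder row D1, ROUTE T (β1), STUB P of the row's ONE file, (C) part 3 of 5 (J-NOTE-20 §8, R-AN2-76-PB's VALUE
# half): **THE COMPOSITE AVERAGING ROWS, THE NESTED SLICE `N` AND THE PRODUCT `N·W₀` AGREE AT CORRESPONDING SLOTS ∕ BONDS OF TWO TOWERS** (generic `Q` under (TB) + (TQ))

SETTING (parts 1–5 of (C)).  Two towers over top tori `M`, `M′` (`Lc ∣ M i`, `Lc ∣ M′ i`), same `Lc`, `lev`, `rs`, depth `n+1`; a block shift `v : Site (d+1)`: top sites move by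
`Lc • v`, the finest sites by `bigRatio Lc (n+1) • v = Lc^(n+2) • v`; slots correspond («Corr») when the sites of `towerEquiv⁻¹` differ by that shift, finest bonds when their base
points do (same direction).  Objects as in parts (A1)(A2): `N := fromRows (τ₂·Q₁₀) τ₁` (letter `hN`), `Q₁₀ = compRowsG Lc Q M lev rs (n+1)` for a GENERIC `Q : StepRows d Lc`
under the displayed letters (TB) (two-block support of non-wrapping rows) and (TQ) (block-translation covariance of non-wrapping rows:
`↑a′ = ↑a + Lc•v → ↑b′ = ↑b + Lc•(Lc•v) → ↑a + e_ν ∈ pbox M → ↑a′ + e_ν ∈ pbox M′ → Q M ℓ r (a,ν) (b,κ) = Q M′ ℓ r (a′,ν) (b′,κ)`), both discharged at the record's `QSym Lc`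
(`FP/QstepSymTwoBlock`, `FP/QstepSymBlockTranslate`); `τ₁ = bigP` of the lower tower, `τ₂ = combF`, `W₀ = towerGen`, `E = towerEvalC`.

WHAT, this part ([folklore]; no `def`, no `def … : Prop`, nothing cited, 0 sorry, default heartbeats): §1 `mem_fine_of_twoBlock_shift ∕ _unshift`, **`compRowsG_apply_corr`**
(`compRowsG Q M lev rs k (a,ν) c = compRowsG Q M′ lev rs k (a′,ν) c′` for `a′ = a + Lc•v`, `c′ = c + bigRatio•v`, both rows non-wrapping — induction on the depth; the step
re-indexes the finite sum over the intermediate fine bonds along `b ↦ b + Lc•(Lc•v)` ON THE SUPPORTS (part 1 §0 `sum_eq_sum_of_rel`): both supports lie under the two blocks by (TB),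
so the shifted bond is a fine-box bond of the other tower and again non-wrapping; the one-step factor agrees by (TQ), the lower composite by the induction hypothesis at the
lower shift `Lc • v`); §2 **`combF_mul_compRowsG_apply_corr`** (the top rows `τ₂·Q₁₀`: part 2 `combF_mul_apply` + §1; the comb bond into `t̄` does not wrap), **`nestedRows_apply_corr`**
(`N p b = N′ p′ b′` — top slots §2, lower slots part 2 `bigP_apply_corr` at the lower shift), `quo_corr` (`γ′ p′ = γ p + v`), **`nestedRows_mul_towerGen_apply_corr`**
(`(N·W₀) p q = (N′·W₀′) p′ q′` — the bond sum re-indexed along `b ↦ b + bigRatio•v` on the supports, which by (L1) consist of bonds INSIDE the slot's big block (hence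
non-wrapping, and their shifts are box bonds of the other tower inside the partner's block); factors by `nestedRows_apply_corr` and part 2 `towerGen_apply_corr`).
WHAT THIS IS NOT: not (P-c) itself (the lattice `λℤ` as a `def`, its `Mc B`-periodisation = `lv` — the row's, on top of this identity); `hlve` NOT instantiated; no row of
v9∕v10 discharged; nothing of Bałaban's asserted, valued or discharged; 0 estimates; 0∕4 row-D1 binders (hW, hR, D1Tel, D1Rep); ROOT M‴ p325680 untouched; NOT (C1), NOT (L2′),
NOT (T-ID), NOT SDF, NOT D1, NEVER «G-an2-4 closed», NOT BetaPertH, NOT continuum, NOT Clay.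

HONEST DEPENDENCY (page 1, mandatory): continuum YM on T⁴ ⇐ BetaPertH ∧ nine spine estimates (0/9 proved); BetaPertH ⇐ (D1) ∧ (D4) ∧ CAP+tail;
G-an2-4 gates asym, D1 and NE2/3/4.  HONEST FRAMING (cell contract, verbatim): «discharging `BetaPertH` makes Bałaban's UV stability UNCONDITIONAL —
a real constructive-QFT result; it is NOT the continuum limit and NOT the Clay problem.»  ABSOLUTE RULE (cell charter, verbatim): «No internally-minted
statement may enter as a cited fact. Every hypothesis is either kernel-proved in this package or a verbatim quotation of a PUBLISHED theorem with page
reference. The manuscript(s) under audit are NOT citable for their own disputed steps — they are the thing under adjudication; programme-internal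
(2001/route/tribunal) claims are never citable.»  Road «FP» OWNER, b2b-balaban-beta-d1-p3 gen 54, 2026-08-29.  No existing file touched.
-/

noncomputable section

namespace Summit.QuantumFields.BalabanUV.Beta.FP.TorusNestedReadoutTranslateRows

open Matrix Finset
open scoped BigOperators
open Literature.MathematicalPhysics.QuantumFieldTheory
open Literature.MathematicalPhysics.QuantumFieldTheory.Balaban1983to89
open Literature.MathematicalPhysics.QuantumFieldTheory.Balaban1983to89.Beta
open B5Prop11Plancherel (fine)
open B6Lemma24Torus (pbox mem_pbox)
open AffineAveraging (Site toSite unitVec)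
open OneStepResolventKernel (Fib)
open Literature.MathematicalPhysics.QuantumFieldTheory.LatticeForm (quo)
open Summit.QuantumFields.BalabanUV.Beta.FP.KernelPeriodisationFib (Idx)
open Summit.QuantumFields.BalabanUV.Beta.FP.TorusCombForest
open Summit.QuantumFields.BalabanUV.Beta.FP.TorusCombRows (Res combRowsT combBondT combBondT_eq baseOf_mem_pbox tipOf_mem_pbox)
open Summit.QuantumFields.BalabanUV.Beta.FP.TorusCombNestedBasis (quo_lift quo_mem_pbox)
open Summit.QuantumFields.BalabanUV.Beta.FP.TorusCompositeObjects
open Summit.QuantumFields.BalabanUV.Beta.FP.TorusCompositeObjectsG (StepRows compRowsG compRowsG_zero compRowsG_succ)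
open Summit.QuantumFields.BalabanUV.Beta.FP.TorusCompositeUnimodular (towerEvalC bigRatio_dvd_towerTorus)
open Summit.QuantumFields.BalabanUV.Beta.FP.TorusNestedReadoutRows
open Summit.QuantumFields.BalabanUV.Beta.FP.TorusNestedReadoutLocality
open Summit.QuantumFields.BalabanUV.Beta.FP.TorusCombTranslate
open Summit.QuantumFields.BalabanUV.Beta.FP.TorusNestedReadoutTranslate

variable {d : ℕ}

section Rows

variable (Lc : ℕ) [NeZero Lc] (Q : StepRows d Lc)
  (hQ : ∀ (M : Fin (d + 1) → ℕ) [∀ μ, NeZero (M μ)] (ℓ : ℕ) (r : Fin (d + 1) → ℕ) (a : ↥(pbox M)) (ν : Fin (d + 1))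
      (b : ↥(pbox (fine Lc M))) (κ : Fin (d + 1)),
      (a : Site (d + 1)) + unitVec ν ∈ pbox M → Q M ℓ r (a, ν) (b, κ) ≠ 0 →
        (quo Lc (b : Site (d + 1)) = a ∨ quo Lc (b : Site (d + 1)) = (a : Site (d + 1)) + unitVec ν) ∧
        (quo Lc ((b : Site (d + 1)) + unitVec κ) = a ∨ quo Lc ((b : Site (d + 1)) + unitVec κ) = (a : Site (d + 1)) + unitVec ν))
  (hQt : ∀ (M M' : Fin (d + 1) → ℕ) [∀ μ, NeZero (M μ)] [∀ μ, NeZero (M' μ)] (ℓ : ℕ) (r : Fin (d + 1) → ℕ) (v : Site (d + 1))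
      (a : ↥(pbox M)) (a' : ↥(pbox M')) (ν : Fin (d + 1)) (b : ↥(pbox (fine Lc M))) (b' : ↥(pbox (fine Lc M'))) (κ : Fin (d + 1)),
      (a' : Site (d + 1)) = (a : Site (d + 1)) + (Lc : ℤ) • v → (b' : Site (d + 1)) = (b : Site (d + 1)) + (Lc : ℤ) • ((Lc : ℤ) • v) →
      (a : Site (d + 1)) + unitVec ν ∈ pbox M → (a' : Site (d + 1)) + unitVec ν ∈ pbox M' →
        Q M ℓ r (a, ν) (b, κ) = Q M' ℓ r (a', ν) (b', κ))
include hQ hQt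

/-! ## §1 The composite averaging rows of corresponding non-wrapping coarse bonds agree (induction under (TB) + (TQ)) -/

omit hQ hQt in
/-- [folklore] a fine point under one of the two blocks of a non-wrapping coarse bond, moved with the blocks, stays in the fine box. -/
theorem mem_fine_of_twoBlock_shift {M M' : Fin (d + 1) → ℕ} {a : ↥(pbox M)} {a' : ↥(pbox M')} {ν : Fin (d + 1)} {v : Site (d + 1)}
    (ha' : (a' : Site (d + 1)) = (a : Site (d + 1)) + (Lc : ℤ) • v) (hat' : (a' : Site (d + 1)) + unitVec ν ∈ pbox M') {x : Site (d + 1)}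
    (hx : quo Lc x = a ∨ quo Lc x = (a : Site (d + 1)) + unitVec ν) : x + (Lc : ℤ) • ((Lc : ℤ) • v) ∈ pbox (fine Lc M') := by
  have hLc : 0 < Lc := Nat.pos_of_ne_zero (NeZero.ne Lc)
  rw [mem_pbox_fine_iff hLc, quo_add_zsmul hLc]
  rcases hx with e | e <;> rw [e]
  · rw [← ha']; exact a'.2
  · rw [add_right_comm, ← ha']; exact hat'

omit hQ hQt in
/-- [folklore] the same, moving back. -/
theorem mem_fine_of_twoBlock_unshift {M M' : Fin (d + 1) → ℕ} {a : ↥(pbox M)} {a' : ↥(pbox M')} {ν : Fin (d + 1)} {v : Site (d + 1)}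
    (ha' : (a' : Site (d + 1)) = (a : Site (d + 1)) + (Lc : ℤ) • v) (hat : (a : Site (d + 1)) + unitVec ν ∈ pbox M) {x : Site (d + 1)}
    (hx : quo Lc x = a' ∨ quo Lc x = (a' : Site (d + 1)) + unitVec ν) : x + (Lc : ℤ) • ((Lc : ℤ) • (-v)) ∈ pbox (fine Lc M) := by
  have hLc : 0 < Lc := Nat.pos_of_ne_zero (NeZero.ne Lc)
  rw [mem_pbox_fine_iff hLc, quo_add_zsmul hLc]
  have e0 : (a' : Site (d + 1)) + (Lc : ℤ) • (-v) = a := by rw [ha', smul_neg]; abel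
  rcases hx with e | e <;> rw [e]
  · rw [e0]; exact a.2
  · rw [add_right_comm, e0]; exact hat

/-- [folklore] **THE COMPOSITE AVERAGING ROWS OF CORRESPONDING NON-WRAPPING COARSE BONDS AGREE**: `compRowsG Q M lev rs k (a,ν) c = compRowsG Q M′ lev rs k (a′,ν) c′` when
`a′ = a + Lc•v`, `c′ = c + bigRatio Lc k • v` — induction on the depth; the step re-indexes the finite sum over the intermediate fine bonds along `b ↦ b + Lc•(Lc•v)` on
the supports (both supports lie under the two blocks by (TB); the factors agree by (TQ) and the induction hypothesis at the lower shift `Lc • v`). -/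
theorem compRowsG_apply_corr : ∀ (k : ℕ) (M M' : Fin (d + 1) → ℕ) [∀ μ, NeZero (M μ)] [∀ μ, NeZero (M' μ)] (lev : ℕ → ℕ) (rs : ℕ → (Fin (d + 1) → ℕ))
    (v : Site (d + 1)) (a : ↥(pbox M)) (a' : ↥(pbox M')) (ν : Fin (d + 1))
    (c : ↥(pbox (towerTorus Lc M k)) × Fin (d + 1)) (c' : ↥(pbox (towerTorus Lc M' k)) × Fin (d + 1)),
    (a' : Site (d + 1)) = (a : Site (d + 1)) + (Lc : ℤ) • v → (c'.1 : Site (d + 1)) = (c.1 : Site (d + 1)) + ((bigRatio Lc k : ℕ) : ℤ) • v → c'.2 = c.2 →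
    (a : Site (d + 1)) + unitVec ν ∈ pbox M → (a' : Site (d + 1)) + unitVec ν ∈ pbox M' →
      compRowsG Lc Q M lev rs k (a, ν) c = compRowsG Lc Q M' lev rs k (a', ν) c'
  | 0, M, M', _, _, lev, rs, v, a, a', ν, c, c', ha', hc, hc2, hat, hat' => by
    rw [compRowsG_zero, compRowsG_zero, Matrix.one_apply, Matrix.one_apply]
    rw [bigRatio_zero] at hc
    by_cases h : ((a, ν) : ↥(pbox M) × Fin (d + 1)) = c
    · subst h
      have h' : c' = (a', ν) := Prod.ext (Subtype.ext (hc.trans ha'.symm)) hc2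
      rw [if_pos rfl, h', if_pos rfl]
    · have h' : ¬ ((a', ν) : ↥(pbox M') × Fin (d + 1)) = c' := by
        intro e
        apply h
        have e1 : ((a' : ↥(pbox M')) : Site (d + 1)) = (c'.1 : Site (d + 1)) := by rw [← e]
        rw [ha', hc, add_left_inj] at e1
        have e2 : ν = c'.2 := by rw [← e]
        rw [hc2] at e2
        exact Prod.ext (Subtype.ext e1) e2
      rw [if_neg h, if_neg h']
  | k + 1, M, M', _, _, lev, rs, v, a, a', ν, c, c', ha', hc, hc2, hat, hat' => by
    have hLc : 0 < Lc := Nat.pos_of_ne_zero (NeZero.ne Lc)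
    rw [compRowsG_succ, compRowsG_succ, Matrix.mul_apply, Matrix.mul_apply]
    rw [bigRatio_succ_zsmul] at hc
    -- the termwise identification on corresponding non-wrapping fine bonds
    have hterm : ∀ (bκ : ↥(pbox (fine Lc M)) × Fin (d + 1)) (bκ' : ↥(pbox (fine Lc M')) × Fin (d + 1)),
        (bκ'.1 : Site (d + 1)) = (bκ.1 : Site (d + 1)) + (Lc : ℤ) • ((Lc : ℤ) • v) → bκ'.2 = bκ.2 →
        (bκ.1 : Site (d + 1)) + unitVec bκ.2 ∈ pbox (fine Lc M) → (bκ'.1 : Site (d + 1)) + unitVec bκ'.2 ∈ pbox (fine Lc M') →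
          Q M (lev 1) (rs 1) (a, ν) bκ * compRowsG Lc Q (fine Lc M) (fun j => lev (j + 1)) (fun j => rs (j + 1)) k bκ c
            = Q M' (lev 1) (rs 1) (a', ν) bκ' * compRowsG Lc Q (fine Lc M') (fun j => lev (j + 1)) (fun j => rs (j + 1)) k bκ' c' := by
      rintro ⟨b, κ⟩ ⟨b', κ'⟩ hb hκ hbt hbt'
      simp only at hb hκ hbt hbt'
      subst κ'
      rw [hQt M M' (lev 1) (rs 1) v a a' ν b b' κ ha' hb hat hat',
        compRowsG_apply_corr k (fine Lc M) (fine Lc M') (fun j => lev (j + 1)) (fun j => rs (j + 1)) ((Lc : ℤ) • v) b b' κ c c' hb hc hc2 hbt hbt']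
    refine sum_eq_sum_of_rel _ _ (fun bκ bκ' => (bκ'.1 : Site (d + 1)) = (bκ.1 : Site (d + 1)) + (Lc : ℤ) • ((Lc : ℤ) • v) ∧ bκ'.2 = bκ.2)
      (fun bκ i' j' hi hj => Prod.ext (Subtype.ext (hi.1.trans hj.1.symm)) (hi.2.trans hj.2.symm))
      (fun bκ₁ bκ₂ bκ' h₁ h₂ => Prod.ext (Subtype.ext (add_right_cancel (h₁.1.symm.trans h₂.1))) (h₁.2.symm.trans h₂.2))
      (fun bκ hne => ?_) (fun bκ' hne => ?_) (fun bκ bκ' hR => ?_)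
    · -- a nonzero source term: its fine bond lies under the two blocks, so its shift is a fine-box point of `M'`
      obtain ⟨h1, _⟩ := hQ M (lev 1) (rs 1) a ν bκ.1 bκ.2 hat (left_ne_zero_of_mul hne)
      exact ⟨(⟨(bκ.1 : Site (d + 1)) + (Lc : ℤ) • ((Lc : ℤ) • v), mem_fine_of_twoBlock_shift Lc ha' hat' h1⟩, bκ.2), rfl, rfl⟩
    · obtain ⟨h1, _⟩ := hQ M' (lev 1) (rs 1) a' ν bκ'.1 bκ'.2 hat' (left_ne_zero_of_mul hne)
      refine ⟨(⟨(bκ'.1 : Site (d + 1)) + (Lc : ℤ) • ((Lc : ℤ) • (-v)), mem_fine_of_twoBlock_unshift Lc ha' hat h1⟩, bκ'.2), ?_, rfl⟩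
      show (bκ'.1 : Site (d + 1)) = (bκ'.1 : Site (d + 1)) + (Lc : ℤ) • ((Lc : ℤ) • (-v)) + (Lc : ℤ) • ((Lc : ℤ) • v)
      rw [smul_neg, smul_neg, add_assoc, neg_add_cancel, add_zero]
    · -- partners carry equal terms: either both vanish or both bonds are non-wrapping
      by_cases hz : Q M (lev 1) (rs 1) (a, ν) bκ = 0
      · by_cases hz' : Q M' (lev 1) (rs 1) (a', ν) bκ' = 0
        · rw [hz, hz', zero_mul, zero_mul]
        · obtain ⟨h1, h2⟩ := hQ M' (lev 1) (rs 1) a' ν bκ'.1 bκ'.2 hat' hz'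
          have hbt' : (bκ'.1 : Site (d + 1)) + unitVec bκ'.2 ∈ pbox (fine Lc M') := by
            rw [mem_pbox_fine_iff hLc]; rcases h2 with e | e <;> rw [e]; exacts [a'.2, hat']
          have hbt : (bκ.1 : Site (d + 1)) + unitVec bκ.2 ∈ pbox (fine Lc M) := by
            have e := mem_fine_of_twoBlock_unshift Lc ha' hat h2
            have ee : (bκ'.1 : Site (d + 1)) + unitVec bκ'.2 + (Lc : ℤ) • ((Lc : ℤ) • (-v)) = (bκ.1 : Site (d + 1)) + unitVec bκ.2 := by
              rw [hR.1, hR.2, smul_neg, smul_neg]; abel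
            rwa [ee] at e
          exact hterm bκ bκ' hR.1 hR.2 hbt hbt'
      · obtain ⟨h1, h2⟩ := hQ M (lev 1) (rs 1) a ν bκ.1 bκ.2 hat hz
        have hbt : (bκ.1 : Site (d + 1)) + unitVec bκ.2 ∈ pbox (fine Lc M) := by
          rw [mem_pbox_fine_iff hLc]; rcases h2 with e | e <;> rw [e]; exacts [a.2, hat]
        have hbt' : (bκ'.1 : Site (d + 1)) + unitVec bκ'.2 ∈ pbox (fine Lc M') := by
          have e := mem_fine_of_twoBlock_shift Lc ha' hat' h2
          have ee : (bκ.1 : Site (d + 1)) + unitVec bκ.2 + (Lc : ℤ) • ((Lc : ℤ) • v) = (bκ'.1 : Site (d + 1)) + unitVec bκ'.2 := by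
            rw [hR.1, hR.2]; abel
          rwa [ee] at e
        exact hterm bκ bκ' hR.1 hR.2 hbt hbt'

/-! ## §2 The top rows, the whole nested slice, and `N·W₀` at corresponding slots -/

/-- [folklore] **THE TOP ROWS `τ₂·Q₁₀` OF CORRESPONDING TOP SLOTS AGREE** (the comb bond into `t̄′ = t̄ + Lc•v` is the comb bond into `t̄` moved; §1). -/
theorem combF_mul_compRowsG_apply_corr (M M' : Fin (d + 1) → ℕ) [∀ μ, NeZero (M μ)] [∀ μ, NeZero (M' μ)] (lev : ℕ → ℕ) (rs : ℕ → (Fin (d + 1) → ℕ))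
    (hrs0 : ∀ i, 0 ≤ toSite (rs 0) i ∧ toSite (rs 0) i < (Lc : ℤ)) (hM : ∀ i, Lc ∣ M i) (hM' : ∀ i, Lc ∣ M' i) (n : ℕ) (v : Site (d + 1))
    (t : Res (toSite (rs 0)) Lc M) (t' : Res (toSite (rs 0)) Lc M') (ht : t'.site = t.site + (Lc : ℤ) • v)
    (c : ↥(pbox (towerTorus Lc M (n + 1))) × Fin (d + 1)) (c' : ↥(pbox (towerTorus Lc M' (n + 1))) × Fin (d + 1))
    (hc : (c'.1 : Site (d + 1)) = (c.1 : Site (d + 1)) + ((bigRatio Lc (n + 1) : ℕ) : ℤ) • v) (hc2 : c'.2 = c.2) :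
    (combF Lc M (rs 0) * compRowsG Lc Q M lev rs (n + 1)) t c = (combF Lc M' (rs 0) * compRowsG Lc Q M' lev rs (n + 1)) t' c' := by
  have hLc : 0 < Lc := Nat.pos_of_ne_zero (NeZero.ne Lc)
  rw [combF_mul_apply Lc M (rs 0) hrs0 hM, combF_mul_apply Lc M' (rs 0) hrs0 hM']
  have hb : baseOf (toSite (rs 0)) Lc t'.site = baseOf (toSite (rs 0)) Lc t.site + (Lc : ℤ) • v := by rw [ht, baseOf_add_zsmul hLc]
  have hax : axisOf (toSite (rs 0)) Lc t'.site = axisOf (toSite (rs 0)) Lc t.site := by rw [ht, axisOf_add_zsmul hLc]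
  have h2 := tipOf_mem_pbox hLc hrs0 hM' t'
  rw [tipOf_eq, hax] at h2
  rw [hax]
  exact compRowsG_apply_corr Lc Q hQ hQt (n + 1) M M' lev rs v ⟨baseOf (toSite (rs 0)) Lc t.site, baseOf_mem_pbox hLc hrs0 hM t⟩
    ⟨baseOf (toSite (rs 0)) Lc t'.site, baseOf_mem_pbox hLc hrs0 hM' t'⟩ (axisOf (toSite (rs 0)) Lc t.site) c c' hb hc hc2 (tipOf_mem_pbox hLc hrs0 hM t) h2

/-- [folklore] **THE NESTED SLICE AT CORRESPONDING SLOTS AND BONDS AGREES**: `N p b = N′ p′ b′` (top slots: the top rows; lower slots: the one-shot comb rows of the lower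
towers at the lower shift `Lc • v`). -/
theorem nestedRows_apply_corr (M M' : Fin (d + 1) → ℕ) [∀ μ, NeZero (M μ)] [∀ μ, NeZero (M' μ)] (lev : ℕ → ℕ) (rs : ℕ → (Fin (d + 1) → ℕ))
    (hrs : ∀ k i, 0 ≤ toSite (rs k) i ∧ toSite (rs k) i < (Lc : ℤ)) (hM : ∀ i, Lc ∣ M i) (hM' : ∀ i, Lc ∣ M' i) (n : ℕ) (v : Site (d + 1))
    (p : NParam Lc M rs (n + 1)) (p' : NParam Lc M' rs (n + 1))
    (hp : ((towerEquiv Lc M' rs hrs (n + 1)).symm p').site = ((towerEquiv Lc M rs hrs (n + 1)).symm p).site + ((bigRatio Lc (n + 1) : ℕ) : ℤ) • v)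
    (b : ↥(pbox (towerTorus Lc M (n + 1))) × Fin (d + 1)) (b' : ↥(pbox (towerTorus Lc M' (n + 1))) × Fin (d + 1))
    (hb : (b'.1 : Site (d + 1)) = (b.1 : Site (d + 1)) + ((bigRatio Lc (n + 1) : ℕ) : ℤ) • v) (hb2 : b'.2 = b.2) :
    (Matrix.fromRows (combF Lc M (rs 0) * compRowsG Lc Q M lev rs (n + 1)) (bigP Lc (fine Lc M) (fun k => rs (k + 1)) (fun k => hrs (k + 1)) n)
        : Matrix (NParam Lc M rs (n + 1)) (↥(pbox (towerTorus Lc M (n + 1))) × Fin (d + 1)) ℝ) p b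
      = (Matrix.fromRows (combF Lc M' (rs 0) * compRowsG Lc Q M' lev rs (n + 1)) (bigP Lc (fine Lc M') (fun k => rs (k + 1)) (fun k => hrs (k + 1)) n)
        : Matrix (NParam Lc M' rs (n + 1)) (↥(pbox (towerTorus Lc M' (n + 1))) × Fin (d + 1)) ℝ) p' b' := by
  rcases p with t | x
  · obtain ⟨t', rfl, ht⟩ := corr_succ_inl Lc M M' rs hrs n v t p' hp
    rw [Matrix.fromRows_apply_inl, Matrix.fromRows_apply_inl]
    exact combF_mul_compRowsG_apply_corr Lc Q hQ hQt M M' lev rs (hrs 0) hM hM' n v t t' ht b b' hb hb2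
  · obtain ⟨x', rfl, hx⟩ := corr_succ_inr Lc M M' rs hrs n v x p' hp
    rw [Matrix.fromRows_apply_inr, Matrix.fromRows_apply_inr]
    rw [bigRatio_succ_zsmul] at hb
    exact bigP_apply_corr Lc (fine Lc M) (fine Lc M') (fun k => rs (k + 1)) (fun k => hrs (k + 1)) (fun i => Dvd.intro (M i) rfl) (fun i => Dvd.intro (M' i) rfl)
      n ((Lc : ℤ) • v) x x' hx b b' hb hb2

omit hQ hQt in
/-- [folklore] the big blocks of corresponding slots correspond: `γ′ p′ = γ p + v`. -/
theorem quo_corr (M M' : Fin (d + 1) → ℕ) (rs : ℕ → (Fin (d + 1) → ℕ)) (hrs : ∀ k i, 0 ≤ toSite (rs k) i ∧ toSite (rs k) i < (Lc : ℤ))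
    (n : ℕ) (v : Site (d + 1)) (p : NParam Lc M rs (n + 1)) (p' : NParam Lc M' rs (n + 1))
    (hp : ((towerEquiv Lc M' rs hrs (n + 1)).symm p').site = ((towerEquiv Lc M rs hrs (n + 1)).symm p).site + ((bigRatio Lc (n + 1) : ℕ) : ℤ) • v) :
    quo (bigRatio Lc (n + 1)) ((towerEquiv Lc M' rs hrs (n + 1)).symm p').site = quo (bigRatio Lc (n + 1)) ((towerEquiv Lc M rs hrs (n + 1)).symm p).site + v := by
  rw [hp, quo_add_zsmul (bigRatio_pos Lc (Nat.pos_of_ne_zero (NeZero.ne Lc)) (n + 1))]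

/-- [folklore] **`N·W₀` AT CORRESPONDING SLOTS AGREES**: `(N·W₀) p q = (N′·W₀′) p′ q′` — the finite sum over the finest bonds re-indexed along `b ↦ b + bigRatio•v` on the supports
(both supports consist of bonds inside the slot's big block by (L1), so the shifted bond is a box bond of the other tower; the factors agree by `nestedRows_apply_corr` and,
on non-wrapping bonds, `towerGen_apply_corr`). -/
theorem nestedRows_mul_towerGen_apply_corr (M M' : Fin (d + 1) → ℕ) [∀ μ, NeZero (M μ)] [∀ μ, NeZero (M' μ)] (lev : ℕ → ℕ) (rs : ℕ → (Fin (d + 1) → ℕ))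
    (hrs : ∀ k i, 0 ≤ toSite (rs k) i ∧ toSite (rs k) i < (Lc : ℤ)) (hM : ∀ i, Lc ∣ M i) (hM' : ∀ i, Lc ∣ M' i) (n : ℕ) (v : Site (d + 1))
    {Q₁₀ : Matrix (↥(pbox M) × Fin (d + 1)) (↥(pbox (towerTorus Lc M (n + 1))) × Fin (d + 1)) ℝ} (hQ₁₀ : Q₁₀ = compRowsG Lc Q M lev rs (n + 1))
    {τ₁ : Matrix (NParam Lc (fine Lc M) (fun k => rs (k + 1)) n) (↥(pbox (towerTorus Lc M (n + 1))) × Fin (d + 1)) ℝ}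
    (hτ₁ : τ₁ = bigP Lc (fine Lc M) (fun k => rs (k + 1)) (fun k => hrs (k + 1)) n)
    {τ₂ : Matrix (Res (toSite (rs 0)) Lc M) (↥(pbox M) × Fin (d + 1)) ℝ} (hτ₂ : τ₂ = combF Lc M (rs 0))
    {N : Matrix (NParam Lc M rs (n + 1)) (↥(pbox (towerTorus Lc M (n + 1))) × Fin (d + 1)) ℝ} (hN : N = Matrix.fromRows (τ₂ * Q₁₀) τ₁)
    {W₀ : Matrix (↥(pbox (towerTorus Lc M (n + 1))) × Fin (d + 1)) (NParam Lc M rs (n + 1)) ℝ} (hW₀ : W₀ = towerGen Lc M rs (n + 1))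
    {Q₁₀' : Matrix (↥(pbox M') × Fin (d + 1)) (↥(pbox (towerTorus Lc M' (n + 1))) × Fin (d + 1)) ℝ} (hQ₁₀' : Q₁₀' = compRowsG Lc Q M' lev rs (n + 1))
    {τ₁' : Matrix (NParam Lc (fine Lc M') (fun k => rs (k + 1)) n) (↥(pbox (towerTorus Lc M' (n + 1))) × Fin (d + 1)) ℝ}
    (hτ₁' : τ₁' = bigP Lc (fine Lc M') (fun k => rs (k + 1)) (fun k => hrs (k + 1)) n)
    {τ₂' : Matrix (Res (toSite (rs 0)) Lc M') (↥(pbox M') × Fin (d + 1)) ℝ} (hτ₂' : τ₂' = combF Lc M' (rs 0))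
    {N' : Matrix (NParam Lc M' rs (n + 1)) (↥(pbox (towerTorus Lc M' (n + 1))) × Fin (d + 1)) ℝ} (hN' : N' = Matrix.fromRows (τ₂' * Q₁₀') τ₁')
    {W₀' : Matrix (↥(pbox (towerTorus Lc M' (n + 1))) × Fin (d + 1)) (NParam Lc M' rs (n + 1)) ℝ} (hW₀' : W₀' = towerGen Lc M' rs (n + 1))
    (p q : NParam Lc M rs (n + 1)) (p' q' : NParam Lc M' rs (n + 1))
    (hp : ((towerEquiv Lc M' rs hrs (n + 1)).symm p').site = ((towerEquiv Lc M rs hrs (n + 1)).symm p).site + ((bigRatio Lc (n + 1) : ℕ) : ℤ) • v)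
    (hq : ((towerEquiv Lc M' rs hrs (n + 1)).symm q').site = ((towerEquiv Lc M rs hrs (n + 1)).symm q).site + ((bigRatio Lc (n + 1) : ℕ) : ℤ) • v) :
    (N * W₀) p q = (N' * W₀') p' q' := by
  have hLc : 0 < Lc := Nat.pos_of_ne_zero (NeZero.ne Lc)
  have hL : 0 < bigRatio Lc (n + 1) := bigRatio_pos Lc hLc (n + 1)
  subst hQ₁₀ hτ₁ hτ₂ hQ₁₀' hτ₁' hτ₂'
  rw [Matrix.mul_apply, Matrix.mul_apply, hN, hW₀, hN', hW₀']
  have hγ := quo_corr Lc M M' rs hrs n v p p' hp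
  refine sum_eq_sum_of_rel _ _
    (fun b b' => (b'.1 : Site (d + 1)) = (b.1 : Site (d + 1)) + ((bigRatio Lc (n + 1) : ℕ) : ℤ) • v ∧ b'.2 = b.2)
    (fun b i' j' hi hj => Prod.ext (Subtype.ext (hi.1.trans hj.1.symm)) (hi.2.trans hj.2.symm))
    (fun b₁ b₂ b' h₁ h₂ => Prod.ext (Subtype.ext (add_right_cancel (h₁.1.symm.trans h₂.1))) (h₁.2.symm.trans h₂.2))
    (fun b hne => ?_) (fun b' hne => ?_) (fun b b' hR => ?_)
  · -- a bond read by row `p` lies in `p`'s block, so its shift lies in `p'`'s block, inside the box of `M'`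
    obtain ⟨h1, _⟩ := nestedRows_apply_ne_zero Lc Q hQ M lev rs hrs hM n p b (left_ne_zero_of_mul hne)
    have hmem : (b.1 : Site (d + 1)) + ((bigRatio Lc (n + 1) : ℕ) : ℤ) • v ∈ pbox (towerTorus Lc M' (n + 1)) :=
      mem_pbox_of_quo_eq hL (bigRatio_dvd_towerTorus Lc hM' (n + 1)) ((towerEquiv Lc M' rs hrs (n + 1)).symm p').mem (by rw [quo_add_zsmul hL, h1, hγ])
    exact ⟨(⟨_, hmem⟩, b.2), rfl, rfl⟩
  · obtain ⟨h1, _⟩ := nestedRows_apply_ne_zero Lc Q hQ M' lev rs hrs hM' n p' b' (left_ne_zero_of_mul hne)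
    have hmem : (b'.1 : Site (d + 1)) + ((bigRatio Lc (n + 1) : ℕ) : ℤ) • (-v) ∈ pbox (towerTorus Lc M (n + 1)) :=
      mem_pbox_of_quo_eq hL (bigRatio_dvd_towerTorus Lc hM (n + 1)) ((towerEquiv Lc M rs hrs (n + 1)).symm p).mem
        (by rw [quo_add_zsmul hL, h1, hγ]; abel)
    refine ⟨(⟨_, hmem⟩, b'.2), ?_, rfl⟩
    show (b'.1 : Site (d + 1)) = (b'.1 : Site (d + 1)) + ((bigRatio Lc (n + 1) : ℕ) : ℤ) • (-v) + ((bigRatio Lc (n + 1) : ℕ) : ℤ) • v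
    rw [smul_neg, add_assoc, neg_add_cancel, add_zero]
  · rw [nestedRows_apply_corr Lc Q hQ hQt M M' lev rs hrs hM hM' n v p p' hp b b' hR.1 hR.2]
    by_cases hz : (Matrix.fromRows (combF Lc M' (rs 0) * compRowsG Lc Q M' lev rs (n + 1)) (bigP Lc (fine Lc M') (fun k => rs (k + 1)) (fun k => hrs (k + 1)) n)
        : Matrix (NParam Lc M' rs (n + 1)) (↥(pbox (towerTorus Lc M' (n + 1))) × Fin (d + 1)) ℝ) p' b' = 0
    · rw [hz, zero_mul, zero_mul]
    · -- a read bond is inside the block, hence non-wrapping, on both tori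
      obtain ⟨_, h2'⟩ := nestedRows_apply_ne_zero Lc Q hQ M' lev rs hrs hM' n p' b' hz
      have hz0 := hz
      rw [← nestedRows_apply_corr Lc Q hQ hQt M M' lev rs hrs hM hM' n v p p' hp b b' hR.1 hR.2] at hz0
      obtain ⟨_, h2⟩ := nestedRows_apply_ne_zero Lc Q hQ M lev rs hrs hM n p b hz0
      have hbt : (b.1 : Site (d + 1)) + unitVec b.2 ∈ pbox (towerTorus Lc M (n + 1)) :=
        mem_pbox_of_quo_eq hL (bigRatio_dvd_towerTorus Lc hM (n + 1)) ((towerEquiv Lc M rs hrs (n + 1)).symm p).mem h2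
      have hbt' : (b'.1 : Site (d + 1)) + unitVec b'.2 ∈ pbox (towerTorus Lc M' (n + 1)) :=
        mem_pbox_of_quo_eq hL (bigRatio_dvd_towerTorus Lc hM' (n + 1)) ((towerEquiv Lc M' rs hrs (n + 1)).symm p').mem h2'
      rw [towerGen_apply_corr Lc (n + 1) M M' rs hrs v b b' q q' hq hR.1 hR.2 hbt hbt']

end Rows

end Summit.QuantumFields.BalabanUV.Beta.FP.TorusNestedReadoutTranslateRows

end
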